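import Mathlib.Analysis.SpecialFunctions.Pow.Asymptotics
import Mathlib.Analysis.SpecialFunctions.Pow.Real
import HarnessLib

/-!
# Functional mining for 3D Navier–Stokes: the structural NO-GO (budgeted sieves, the dynamic
# reduction for Galerkin truncations, and the universal three-wave witness)

Search for candidate a priori estimates; no regularity claim.

Cell `pub-nsfunc` (host summit NavierStokesRegularity, topic `FunctionalMining`), no-go branch
(`HOME/NOGO.md`). The companion files `FunctionalMining/Sieves.lean` (real-variable cores of the
space-time-scaling sieve and of the amplitude/parity sieve, case `G ≡ 0`) and
`FunctionalMining/RateBudgets.lean` (the census template `IsRateBudget` on `T³`) are imported /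
referred to; nothing of theirs is re-proved. This file adds, all PROVED (no named fact, no `sorry`):

## Part A — the sieves WITH A BUDGET (abstract, any data class)

For a functional `F` on a data class `P ⊆ X` write its formal rate along Navier–Stokes as
`ν·V − I` (`V` = viscous rate, `I` = inertial = Euler production); a census row is
"`dF/dt ≤ Θ` along every solution", which local solubility turns into `ν V x − I x ≤ Θ x` for every
datum `x ∈ P` (Part C proves this reduction for Galerkin truncations).

* (The space-time SCALING sieve — a budget off the critical line `deg Θ = σ_F + 2` buys nothing
  over plain monotonicity — is `Sieves.exponent_le_of_forall_nat_mul_rpow_le` /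
  `Sieves.exponent_eq_of_forall_mul_rpow_le`; it needs dilations, i.e. `ℝ³` or shrinking bumps on
  `T³`, and is NOT available on a fixed Galerkin truncation. Not restated here.)
* `inertial_eq_zero_of_rate_le` — **budgeted amplitude/parity sieve**: if `V` is even and
  amplitude-homogeneous of degree `m`, `I` odd of degree `m + 1`, and the budget grows at most like
  `A^q` along every amplitude ray `A ≥ 1` with `q < m + 1` (also along the reflected ray), then
  `ν V − I ≤ Θ` on `P` forces `I ≡ 0` on `P`: `F` is a formal invariant of the (truncated) Euler
  dynamics. `Sieves.even_monotone_is_euler_invariant` is the case `Θ = 0`.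
* `neg_inertial_le_of_rate_le_critical` — **critical amplitude degree**: if instead the budget grows
  like `A^(m+1)·Θtop + O(A^q)`, `q < m + 1`, then `ν V − I ≤ Θ` forces `−I ≤ Θtop` POINTWISE on
  `P` (one-sided, no parity): viscosity drops out and the top-degree part of the budget alone must
  dominate the Euler production — the exact content of escape door D2.

## Part B — budget bookkeeping (why the two sieves together cover every Grönwall-closable monomial budget)

* `budgetAmplitudeDegree_lt` — for `F` of amplitude degree `m` and Navier–Stokes scaling degree
  `σ` with `0 ≤ m + 2σ`, every monomial budget `Θ = K^a · F^c · Π Gᵢ^{eᵢ}` (`K` = kinetic energy,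
  `Gᵢ = ‖u‖_{qᵢ}^{pᵢ}` energy-class space–time integrable quantities incl. `‖∇u‖₂²`) that is
  (i) Grönwall-closable (`c ≤ 1`, total `L¹_t` share `Σ eᵢ ≤ 1`) and (ii) on the critical scaling
  line (else the scaling sieve kills it) has amplitude degree `q < m + 1`, so Part A kills it
  unless `F` is a formal Euler invariant. Pure arithmetic; conventions in the docstring.

## Part C — the Galerkin instance (the census's own dynamics), fully proved

On the Galerkin truncation of unforced Navier–Stokes to a finite symmetric mode set `S ⊂ ℤ³`
(`ShellTransfer.IsGalerkinSolution`, tree file `FluidComputer/GalerkinEnergyBalance`), for the class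
`𝒦_quad(S)` of QUADRATIC FOURIER ENERGIES `F_w = Σ_{k∈S} w(k)·½|û(k)|²` (every `Ḣ^s` energy, every
Littlewood–Paley / Fourier-weighted enstrophy restricted to `S`):
* `HoldsAlongGalerkin S ν F Θ` — the census row "`dF/dt ≤ Θ` along every unforced Galerkin
  solution on `S`" (at every time where `F ∘ U` is differentiable its derivative is `≤ Θ(U t)`);
* `hasDerivAt_weightedEnergy_galerkin` — the exact balance `dF_w/dt = −2ν D_w + T_w`;
* `rate_le_of_holdsAlongGalerkin` — **the dynamic reduction**: by global solubility of the
  Galerkin system through every supported datum (`GalerkinODE.exists_galerkinSolution`, tree) a row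
  that holds along all solutions holds as `rate ≤ Θ` at every datum; `holdsAlongGalerkin_iff_rate_le`
  — and conversely (uniqueness of derivatives): trajectories add nothing to a differential row;
* `modeTransfer_scale`, `weightedTransfer_scale` (cubic), `weightedDissipation_scale` (quadratic):
  the amplitude degrees;
* `weightedTransfer_eq_zero_of_holds` — Part A applied: for every SUB-CUBIC budget
  (`SubcubicOn S Θ`: `Θ(A·V) ≤ C_V A^q`, `q < 3`, `A ≥ 1`), a row `dF_w/dt ≤ Θ` forces the
  truncated Euler production `T_w ≡ 0` on all data supported in `S`;
* `weightedTransfer_le_of_holds_critical` — Part A's critical-degree reduction applied: a budget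
  growing like `A³·Θtop + O(A^q)`, `q < 3`, forces the STATIC inequality `T_w ≤ Θtop` on all data
  supported in `S` (conditional-rate rows are functional inequalities; viscosity drops out);
* `weightedTransfer_tw_radial` — **the universal witness**: the three-wave field
  `tw = (2cos y, 0, 2cos x + 2sin(x+y))` (tree: `E = 3, Z = 4, P = 6, T_Z = 2`) has production
  `T_w(tw) = 2(φ(2) − φ(1))` for EVERY radial weight `w(k) = φ(|k|²)`;
* `radial_noGo` — **NO-GO**: for every finite symmetric `S ⊇ B` (`B = {0,±1}²×{0}`, the support
  of `tw`), every `ν ≥ 0`, every radial weight with `φ 1 ≠ φ 2` and every sub-cubic budget `Θ`,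
  the row `d/dt Σ_{k∈S} φ(|k|²)½|û(k)|² ≤ Θ` FAILS along some unforced Galerkin solution on `S`;
  `enstrophy_noGo`, `enstrophy_linearBudget_noGo` (`dZ_S/dt ≤ K·Z_S` fails for every `K`) are the
  headline instances; `SubcubicOn.add`, `subcubicOn_of_homogeneous`, `subcubicOn_zero` show the
  budget class contains every affine/monomial Grönwall budget of amplitude degree `< 3`.

Scope, exactly: Part C decides the census column "differential budget of amplitude degree `< 3`"
for every member of `𝒦_quad(S)` whose radial profile is not constant on the shells `|k|² = 1, 2`
(one witness flow, two signs, one amplitude ray). It says NOTHING about budgets of amplitude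
degree `≥ 3` (e.g. `Z²`, `Z³`: on a fixed truncation these can hold with truncation-dependent
constants; they are decided by the scaling sieve with concentrating data at PDE level, or by the
census), nothing about time-integrated targets, and nothing about non-quadratic functionals beyond
the abstract Part A. `HOME/NOGO.md` lists the typed escape doors.

SPLIT NOTE (prove seat, filing for the no-go seat, 2026-08-20): the staged file `HOME/pub-nsfunc-nogo/NoGo.lean`
(736 lines) exceeds the 400-line limit and is filed verbatim as three modules under
`FunctionalMining/NoGo/`: `BudgetedSieves.lean` (Parts A, B), `GalerkinReduction.lean` (Part C up to
the sub-cubic budgets), `GalerkinWitness.lean` (Part C: the no-go for quadratic Fourier energies and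
the universal three-wave witness). Declarations, names and proofs are unchanged.
-/

noncomputable section

open Filter
open scoped Topology

namespace Summit.NavierStokesRegularity.FunctionalMining

/-! ## Part A — the amplitude/parity sieve with a budget -/

section SymmetryMoves

variable {X : Type*}

/-- **Budgeted amplitude/parity sieve.** On a data class `P ⊆ X` stable under amplitude scaling
`amp A` (`A > 0`) and the sign flip `neg`, let the viscous rate `V` be even and homogeneous of
degree `m`, the inertial rate `I` odd and homogeneous of degree `m + 1`, and let the budget `Θ`
grow at most like `A^q`, `q < m + 1`, along the amplitude ray of every datum of `P`. If
`ν V − I ≤ Θ` on `P` then `I ≡ 0` on `P`: the functional is a formal invariant of the Euler part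
of the dynamics. (Evaluate at `A·x` and `A·(−x)`, divide by `A^{m+1}`, let `A → ∞`.) [folklore] -/
theorem inertial_eq_zero_of_rate_le {P : X → Prop} {amp : ℝ → X → X} {neg : X → X}
    {V I Θ : X → ℝ} {ν m q : ℝ}
    (hP_amp : ∀ A x, 0 < A → P x → P (amp A x)) (hP_neg : ∀ x, P x → P (neg x))
    (hV_amp : ∀ A x, 0 < A → V (amp A x) = A ^ m * V x)
    (hI_amp : ∀ A x, 0 < A → I (amp A x) = A ^ (m + 1) * I x)
    (hV_neg : ∀ x, V (neg x) = V x) (hI_neg : ∀ x, I (neg x) = -I x)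
    (hΘ : ∀ x, P x → ∃ C, ∀ A : ℝ, 1 ≤ A → Θ (amp A x) ≤ C * A ^ q) (hq : q < m + 1)
    (htarget : ∀ x, P x → ν * V x - I x ≤ Θ x) : ∀ x, P x → I x = 0 := by
  intro x hx
  obtain ⟨C₁, hC₁⟩ := hΘ x hx
  obtain ⟨C₂, hC₂⟩ := hΘ (neg x) (hP_neg x hx)
  -- the two-sided bound along the amplitude ray
  have key : ∀ A : ℝ, 1 ≤ A →
      |I x| ≤ (|C₁| + |C₂|) * A ^ (q - (m + 1)) + |ν * V x| * A ^ (-1 : ℝ) := by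
    intro A hA
    have hA0 : 0 < A := by linarith
    have h1 := htarget (amp A x) (hP_amp A x hA0 hx)
    rw [hV_amp A x hA0, hI_amp A x hA0] at h1
    have h2 := htarget (amp A (neg x)) (hP_amp A (neg x) hA0 (hP_neg x hx))
    rw [hV_amp A _ hA0, hI_amp A _ hA0, hV_neg, hI_neg] at h2
    have hb1 := h1.trans (hC₁ A hA)
    have hb2 := h2.trans (hC₂ A hA)
    have hm0 : 0 < A ^ m := Real.rpow_pos_of_pos hA0 m
    have hq0 : 0 < A ^ q := Real.rpow_pos_of_pos hA0 q
    have hsplit : A ^ (m + 1) = A ^ m * A := by rw [Real.rpow_add hA0, Real.rpow_one]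
    rw [hsplit] at hb1 hb2
    have hpos : 0 < A ^ m * A := mul_pos hm0 hA0
    have e1 : C₁ * A ^ q ≤ |C₁| * A ^ q := mul_le_mul_of_nonneg_right (le_abs_self _) hq0.le
    have e2 : C₂ * A ^ q ≤ |C₂| * A ^ q := mul_le_mul_of_nonneg_right (le_abs_self _) hq0.le
    have e3 : -(ν * V x) * A ^ m ≤ |ν * V x| * A ^ m :=
      mul_le_mul_of_nonneg_right (neg_le_abs _) hm0.le
    have e4 : (ν * V x) * A ^ m ≤ |ν * V x| * A ^ m :=
      mul_le_mul_of_nonneg_right (le_abs_self _) hm0.le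
    have e5 : 0 ≤ |C₁| * A ^ q := mul_nonneg (abs_nonneg _) hq0.le
    have e6 : 0 ≤ |C₂| * A ^ q := mul_nonneg (abs_nonneg _) hq0.le
    have habs : |I x * (A ^ m * A)| ≤ (|C₁| + |C₂|) * A ^ q + |ν * V x| * A ^ m := by
      rw [abs_le]
      constructor <;> linarith
    rw [abs_mul, abs_of_pos hpos] at habs
    have hsplit2 : A ^ q = A ^ (q - (m + 1)) * (A ^ m * A) := by
      rw [← hsplit, ← Real.rpow_add hA0]
      congr 1
      ring
    have hinv : A ^ (-1 : ℝ) * (A ^ m * A) = A ^ m := by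
      rw [Real.rpow_neg_one, mul_comm (A ^ m) A, ← mul_assoc, inv_mul_cancel₀ hA0.ne', one_mul]
    have hfac : (|C₁| + |C₂|) * A ^ q + |ν * V x| * A ^ m =
        ((|C₁| + |C₂|) * A ^ (q - (m + 1)) + |ν * V x| * A ^ (-1 : ℝ)) * (A ^ m * A) := by
      rw [hsplit2]
      linear_combination (-|ν * V x|) * hinv
    rw [hfac] at habs
    exact le_of_mul_le_mul_right habs hpos
  -- let `A → ∞`
  have hlim : Tendsto (fun A : ℝ => (|C₁| + |C₂|) * A ^ (q - (m + 1)) + |ν * V x| * A ^ (-1 : ℝ))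
      atTop (𝓝 ((|C₁| + |C₂|) * 0 + |ν * V x| * 0)) := by
    refine Tendsto.add (Tendsto.const_mul _ ?_) (Tendsto.const_mul _ ?_)
    · have e : (fun A : ℝ => A ^ (q - (m + 1))) = fun A : ℝ => A ^ (-(m + 1 - q)) := by
        funext A
        rw [neg_sub]
      rw [e]
      exact tendsto_rpow_neg_atTop (by linarith)
    · exact tendsto_rpow_neg_atTop one_pos
  rw [mul_zero, mul_zero, add_zero] at hlim
  have h0 : |I x| ≤ 0 := ge_of_tendsto hlim (Filter.eventually_atTop.2 ⟨1, key⟩)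
  exact abs_nonpos_iff.mp h0

/-- **Critical amplitude degree: the budget's top coefficient must dominate the inertial term.**
Same setting, one-sided (no parity needed): if the budget grows along the amplitude ray at most
like `A^(m+1) · Θtop x + C · A^q` with `q < m + 1`, then `ν·V − I ≤ Θ` on `P` forces the
POINTWISE inequality `−I x ≤ Θtop x` on `P` — viscosity has dropped out entirely. (Reading: a
budget of the critical amplitude degree `k_F + 1` closes the estimate only if its top-degree part
alone bounds the Euler production of `F` from the dangerous side, for every admissible field;
`HOME/NOGO.md` door D2.) [folklore] -/
theorem neg_inertial_le_of_rate_le_critical {P : X → Prop} {amp : ℝ → X → X}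
    {V I Θ Θtop : X → ℝ} {ν m q : ℝ}
    (hP_amp : ∀ A x, 0 < A → P x → P (amp A x))
    (hV_amp : ∀ A x, 0 < A → V (amp A x) = A ^ m * V x)
    (hI_amp : ∀ A x, 0 < A → I (amp A x) = A ^ (m + 1) * I x)
    (hΘ : ∀ x, P x → ∃ C, ∀ A : ℝ, 1 ≤ A → Θ (amp A x) ≤ A ^ (m + 1) * Θtop x + C * A ^ q)
    (hq : q < m + 1) (htarget : ∀ x, P x → ν * V x - I x ≤ Θ x) :
    ∀ x, P x → -I x ≤ Θtop x := by
  intro x hx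
  obtain ⟨C, hC⟩ := hΘ x hx
  have key : ∀ A : ℝ, 1 ≤ A →
      -I x - Θtop x ≤ |C| * A ^ (q - (m + 1)) + |ν * V x| * A ^ (-1 : ℝ) := by
    intro A hA
    have hA0 : 0 < A := by linarith
    have h1 := htarget (amp A x) (hP_amp A x hA0 hx)
    rw [hV_amp A x hA0, hI_amp A x hA0] at h1
    have hb := h1.trans (hC A hA)
    have hm0 : 0 < A ^ m := Real.rpow_pos_of_pos hA0 m
    have hq0 : 0 < A ^ q := Real.rpow_pos_of_pos hA0 q
    have hsplit : A ^ (m + 1) = A ^ m * A := by rw [Real.rpow_add hA0, Real.rpow_one]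
    rw [hsplit] at hb
    have hpos : 0 < A ^ m * A := mul_pos hm0 hA0
    have e1 : C * A ^ q ≤ |C| * A ^ q := mul_le_mul_of_nonneg_right (le_abs_self _) hq0.le
    have e3 : -(ν * V x) * A ^ m ≤ |ν * V x| * A ^ m :=
      mul_le_mul_of_nonneg_right (neg_le_abs _) hm0.le
    have hmain : (-I x - Θtop x) * (A ^ m * A) ≤ |C| * A ^ q + |ν * V x| * A ^ m := by
      linarith
    have hsplit2 : A ^ q = A ^ (q - (m + 1)) * (A ^ m * A) := by
      rw [← hsplit, ← Real.rpow_add hA0]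
      congr 1
      ring
    have hinv : A ^ (-1 : ℝ) * (A ^ m * A) = A ^ m := by
      rw [Real.rpow_neg_one, mul_comm (A ^ m) A, ← mul_assoc, inv_mul_cancel₀ hA0.ne', one_mul]
    have hfac : |C| * A ^ q + |ν * V x| * A ^ m =
        (|C| * A ^ (q - (m + 1)) + |ν * V x| * A ^ (-1 : ℝ)) * (A ^ m * A) := by
      rw [hsplit2]
      linear_combination (-|ν * V x|) * hinv
    rw [hfac] at hmain
    exact le_of_mul_le_mul_right hmain hpos
  have hlim : Tendsto (fun A : ℝ => |C| * A ^ (q - (m + 1)) + |ν * V x| * A ^ (-1 : ℝ))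
      atTop (𝓝 (|C| * 0 + |ν * V x| * 0)) := by
    refine Tendsto.add (Tendsto.const_mul _ ?_) (Tendsto.const_mul _ ?_)
    · have e : (fun A : ℝ => A ^ (q - (m + 1))) = fun A : ℝ => A ^ (-(m + 1 - q)) := by
        funext A
        rw [neg_sub]
      rw [e]
      exact tendsto_rpow_neg_atTop (by linarith)
    · exact tendsto_rpow_neg_atTop one_pos
  rw [mul_zero, mul_zero, add_zero] at hlim
  have h0 : -I x - Θtop x ≤ 0 := ge_of_tendsto hlim (Filter.eventually_atTop.2 ⟨1, key⟩)
  linarith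

end SymmetryMoves

/-! ## Part B — budget bookkeeping -/

/-- **Every Grönwall-closable monomial budget on the critical line is sub-`(m+1)` in amplitude.**
Conventions (dictionary, `HOME/NOGO.md` §2): `F` has amplitude degree `m` and Navier–Stokes
scaling degree `σ` (`F[λu(λ·)] = λ^σ F[u]` on `ℝ³`); its rate has scaling degree `σ + 2`. A
monomial budget `Θ = K^a · F^c · Π Gᵢ^{eᵢ}` with `K = ½‖u‖₂²` (scaling `−1`, amplitude `2`) and
energy-class integrable factors `Gᵢ = ‖u‖_{qᵢ}^{pᵢ}`, `2/pᵢ + 3/qᵢ = 3/2` (scaling `2 − pᵢ/2`,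
amplitude `pᵢ`; `‖∇u‖₂²` is the case `pᵢ = 2`) has scaling degree `−a + Σeᵢ(2 − pᵢ/2) + cσ` and
amplitude degree `q = 2a + Σeᵢpᵢ + cm`. Write `B = Σ eᵢ` (total `L¹_t` share) and `Q = Σ eᵢ pᵢ`.
If `c ≤ 1` and `B ≤ 1` (Grönwall/Bihari-closable), the budget is on the critical line
(`−a + (2B − Q/2) + cσ = σ + 2`), and `0 ≤ m + 2σ`, then `q < m + 1` — so
`inertial_eq_zero_of_rate_le` applies (indeed `m + 1 − q = (1 − c)(m + 2σ) + 4(1 − B) + 1`). [folklore] -/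
theorem budgetAmplitudeDegree_lt {m σ a c B Q : ℝ} (hc : c ≤ 1) (hB : B ≤ 1) (hmσ : 0 ≤ m + 2 * σ)
    (hcrit : -a + (2 * B - Q / 2) + c * σ = σ + 2) :
    2 * a + Q + c * m < m + 1 := by
  nlinarith [mul_nonneg (sub_nonneg.2 hc) hmσ]

/-- The located gap of Part B in one line: under the same conventions the amplitude defect is
`m + 1 − q = (1 − c)(m + 2σ) + 4(1 − B) + 1 ≥ 1`. [folklore] -/
theorem budgetAmplitudeDefect_eq {m σ a c B Q : ℝ}
    (hcrit : -a + (2 * B - Q / 2) + c * σ = σ + 2) :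
    m + 1 - (2 * a + Q + c * m) = (1 - c) * (m + 2 * σ) + 4 * (1 - B) + 1 := by
  linear_combination 2 * hcrit

end Summit.NavierStokesRegularity.FunctionalMining

end
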